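import Summits.NavierStokesRegularity.NavierStokesRegularity.Theorems.HodographBetchovSlowClassProductionStubSlabProduction
import Summits.NavierStokesRegularity.NavierStokesRegularity.Theorems.HodographBetchovSlowClassProductionStubDeepSlowProduction

/-!
# `SlowClassProduction` (stmt-NavierStokesRegularity-15831), line `birth` — the crux reduced to its collar

Route `HodographBetchov`, crux 2.  With stubs 1 and 2 of the registered skeleton
`Cruxes/SlowClassProduction/Lines/birth.lean` landed as theorems
(`stub_slabProduction`, p150864; `stub_deepSlowProduction`, p152278), the parabolic trichotomy of the
slow class reduces the crux EXACTLY to its load-bearing stub `stub_collarProduction` (the production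
budget of the parabolic `(ν/l)`-collar of the fast set inside the slow class — the open, critical
a-priori statement).  This file records that reduction as a theorem of the tree,
`slowClassProduction_of_collarProduction : (collar budget) → SlowClassProduction`, so that a proof of
the collar budget closes the crux in one line.

The glue is the planner's sorry-free composition `SlowClassProduction_of_stubs` of the skeleton
(measure theory of the partition initial / deep / collar: the deep piece is cut out of the slab
`τ ≤ s ≤ t` by a closed, hence measurable, proxy — continuity of `u` on `[0,T) × ℝ³`), reproduced here
with the two landed stubs plugged in and without auxiliary definitions (the skeleton file itself
carries the open stub as a `sorry` and is not importable).
-/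

noncomputable section

-- the summit and its single problem share the name `NavierStokesRegularity` (D-0017 nested layout)
set_option linter.dupNamespace false

namespace Summit.NavierStokesRegularity.NavierStokesRegularity.Theorems.SlowClassProduction.Birth

open Set MeasureTheory Metric
open scoped ContDiff

section Glue

variable {u : ℝ → EuclideanSpace ℝ (Fin 3) → EuclideanSpace ℝ (Fin 3)}

/-- The closed proxy of the deep region inside the slab `τ ≤ s ≤ t` — the intersection over the
compact parameter set of the cylinder of closed sublevel conditions — is closed, hence measurable, as
soon as `u` is continuous on `[0,T) × ℝ³`, `r² ≤ ν τ` and `t < T` (every shifted cylinder point stays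
in the domain of continuity).  (Planner's glue lemma of `Lines/birth.lean`.) [folklore] -/
theorem measurableSet_deepProxy {ν l τ r t T : ℝ} (hν : 0 < ν) (hrτ : r ^ 2 ≤ ν * τ)
    (htT : t < T)
    (hU : ContinuousOn (Function.uncurry u) (Set.Ico 0 T ×ˢ (Set.univ : Set (EuclideanSpace ℝ (Fin 3))))) :
    MeasurableSet (⋂ σ ∈ Set.Icc (0 : ℝ) (r ^ 2 / ν), ⋂ η ∈ Metric.closedBall (0 : EuclideanSpace ℝ (Fin 3)) r,
      ({z : ℝ × EuclideanSpace ℝ (Fin 3) | z.1 ∈ Set.Icc τ t} ∩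
        (fun z : ℝ × EuclideanSpace ℝ (Fin 3) => u (z.1 - σ) (z.2 + η)) ⁻¹'
          Metric.closedBall (0 : EuclideanSpace ℝ (Fin 3)) l)) := by
  refine IsClosed.measurableSet ?_
  refine isClosed_biInter fun σ hσ => isClosed_biInter fun η _ => ?_
  refine ContinuousOn.preimage_isClosed_of_isClosed ?_ (isClosed_Icc.preimage continuous_fst)
    Metric.isClosed_closedBall
  have hg : Continuous fun z : ℝ × EuclideanSpace ℝ (Fin 3) =>
      ((z.1 - σ, z.2 + η) : ℝ × EuclideanSpace ℝ (Fin 3)) :=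
    (continuous_fst.sub continuous_const).prodMk (continuous_snd.add continuous_const)
  have hστ : r ^ 2 / ν ≤ τ := by
    rw [div_le_iff₀ hν]
    linarith
  have hmaps : Set.MapsTo (fun z : ℝ × EuclideanSpace ℝ (Fin 3) =>
      ((z.1 - σ, z.2 + η) : ℝ × EuclideanSpace ℝ (Fin 3)))
      {z : ℝ × EuclideanSpace ℝ (Fin 3) | z.1 ∈ Set.Icc τ t}
      (Set.Ico 0 T ×ˢ (Set.univ : Set (EuclideanSpace ℝ (Fin 3)))) := by
    intro z hz
    refine Set.mk_mem_prod ⟨?_, ?_⟩ (Set.mem_univ _)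
    · have h1 := hσ.2
      have h2 := hz.1
      linarith
    · have h1 := hσ.1
      have h2 := hz.2
      linarith
  exact hU.comp hg.continuousOn hmaps

/-- Inside the slow class beyond the delay, the proxy cuts out exactly the deep piece.
(Planner's glue lemma of `Lines/birth.lean`.) [folklore] -/
theorem slow_sdiff_inter_deepProxy {ν l τ r t : ℝ} :
    (({z : ℝ × EuclideanSpace ℝ (Fin 3) | z.1 ∈ Set.Ioo 0 t ∧ ‖u z.1 z.2‖ ≤ l} \
        {z : ℝ × EuclideanSpace ℝ (Fin 3) | z.1 < τ}) ∩
      ⋂ σ ∈ Set.Icc (0 : ℝ) (r ^ 2 / ν), ⋂ η ∈ Metric.closedBall (0 : EuclideanSpace ℝ (Fin 3)) r,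
        ({z : ℝ × EuclideanSpace ℝ (Fin 3) | z.1 ∈ Set.Icc τ t} ∩
          (fun z : ℝ × EuclideanSpace ℝ (Fin 3) => u (z.1 - σ) (z.2 + η)) ⁻¹'
            Metric.closedBall (0 : EuclideanSpace ℝ (Fin 3)) l)) =
    {z : ℝ × EuclideanSpace ℝ (Fin 3) | z.1 ∈ Set.Ioo 0 t ∧ ‖u z.1 z.2‖ ≤ l} ∩
      {z : ℝ × EuclideanSpace ℝ (Fin 3) | τ ≤ z.1 ∧
        ∀ s ∈ Set.Icc (z.1 - r ^ 2 / ν) z.1, ∀ y ∈ Metric.closedBall z.2 r, ‖u s y‖ ≤ l} := by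
  ext z
  simp only [Set.mem_inter_iff, Set.mem_sdiff, Set.mem_setOf_eq,
    Set.mem_iInter, Set.mem_preimage, Metric.mem_closedBall, dist_zero_right, not_lt, Set.mem_Icc,
    Set.mem_Ioo]
  constructor
  · rintro ⟨⟨⟨hzt, hzl⟩, hτz⟩, hM⟩
    refine ⟨⟨hzt, hzl⟩, hτz, fun s hs y hy => ?_⟩
    have hy' : ‖y - z.2‖ ≤ r := by rwa [← dist_eq_norm]
    have h := hM (z.1 - s) ⟨by linarith [hs.2], by linarith [hs.1]⟩ (y - z.2) hy'
    simpa [sub_sub_cancel, add_sub_cancel] using h.2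
  · rintro ⟨⟨hzt, hzl⟩, hτz, hD⟩
    refine ⟨⟨⟨hzt, hzl⟩, hτz⟩, fun σ hσ η hη => ⟨⟨hτz, hzt.2.le⟩, ?_⟩⟩
    refine hD (z.1 - σ) ⟨by linarith [hσ.2], by linarith [hσ.1]⟩ (z.2 + η) ?_
    simpa [dist_eq_norm] using hη

/-- Inside the slow class beyond the delay, the complement of the proxy is exactly the collar.
(Planner's glue lemma of `Lines/birth.lean`.) [folklore] -/
theorem slow_sdiff_sdiff_deepProxy {ν l τ r t : ℝ} :
    (({z : ℝ × EuclideanSpace ℝ (Fin 3) | z.1 ∈ Set.Ioo 0 t ∧ ‖u z.1 z.2‖ ≤ l} \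
        {z : ℝ × EuclideanSpace ℝ (Fin 3) | z.1 < τ}) \
      ⋂ σ ∈ Set.Icc (0 : ℝ) (r ^ 2 / ν), ⋂ η ∈ Metric.closedBall (0 : EuclideanSpace ℝ (Fin 3)) r,
        ({z : ℝ × EuclideanSpace ℝ (Fin 3) | z.1 ∈ Set.Icc τ t} ∩
          (fun z : ℝ × EuclideanSpace ℝ (Fin 3) => u (z.1 - σ) (z.2 + η)) ⁻¹'
            Metric.closedBall (0 : EuclideanSpace ℝ (Fin 3)) l)) =
    {z : ℝ × EuclideanSpace ℝ (Fin 3) | z.1 ∈ Set.Ioo 0 t ∧ ‖u z.1 z.2‖ ≤ l} ∩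
      {z : ℝ × EuclideanSpace ℝ (Fin 3) | τ ≤ z.1 ∧
        ∃ s ∈ Set.Icc (z.1 - r ^ 2 / ν) z.1, ∃ y ∈ Metric.closedBall z.2 r, l < ‖u s y‖} := by
  ext z
  simp only [Set.mem_inter_iff, Set.mem_sdiff, Set.mem_setOf_eq,
    Set.mem_iInter, Set.mem_preimage, Metric.mem_closedBall, dist_zero_right, not_lt, Set.mem_Icc,
    Set.mem_Ioo]
  constructor
  · rintro ⟨⟨⟨hzt, hzl⟩, hτz⟩, hM⟩
    push Not at hM
    obtain ⟨σ, hσ, η, hη, hfast⟩ := hM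
    refine ⟨⟨hzt, hzl⟩, hτz, z.1 - σ, ⟨by linarith [hσ.2], by linarith [hσ.1]⟩, z.2 + η, ?_, ?_⟩
    · simpa [dist_eq_norm] using hη
    · exact hfast ⟨hτz, hzt.2.le⟩
  · rintro ⟨⟨hzt, hzl⟩, hτz, s, hs, y, hy, hfast⟩
    refine ⟨⟨⟨hzt, hzl⟩, hτz⟩, fun hM => ?_⟩
    have hy' : ‖y - z.2‖ ≤ r := by rwa [← dist_eq_norm]
    have h := hM (z.1 - s) ⟨by linarith [hs.2], by linarith [hs.1]⟩ (y - z.2) hy'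
    have h2 : ‖u s y‖ ≤ l := by simpa [sub_sub_cancel, add_sub_cancel] using h.2
    exact absurd h2 (not_le.mpr hfast)

end Glue

/-- **The crux `SlowClassProduction` follows from the collar budget** (line `birth`: the planner's
composition `SlowClassProduction_of_stubs` of the registered skeleton with the landed stubs
`stub_slabProduction` and `stub_deepSlowProduction` plugged in).  Hypothesis = the registered stub
`stub_collarProduction` verbatim: for every classical Leray–Hopf solution from a rapidly decaying
datum and every level `l > 0`, SOME admissible delay/radius `(τ, r)` (`0 < τ < T`, `0 < r ≤ ν/l`,
`r² ≤ ν τ`) and `C` bound the production of the collar piece of the slow class on `[0,t]` for all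
`t < T`.  Proof: `C₀ := ∫∫_{(0,τ)×ℝ³} |P|` (stub 1), `C₁` from the deep budget at `(τ, r)` (stub 2),
`C₂` from the hypothesis; split the slow class along `{s < τ}` and along the closed proxy of the deep
region (`integral_inter_add_sdiff` twice) and add. [folklore] -/
theorem slowClassProduction_of_collarProduction :
    (∀ (ν T : ℝ), 0 < ν → 0 < T →
        ∀ (u : ℝ → EuclideanSpace ℝ (Fin 3) → EuclideanSpace ℝ (Fin 3))
          (p : ℝ → EuclideanSpace ℝ (Fin 3) → ℝ),
          Literature.Analysis.FluidPDE.IsClassicalNSSolutionOn (Set.Ico 0 T) ν 0 u p →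
          Literature.Analysis.FluidPDE.IsLerayHopfOn T ν 0 (u 0) u →
          Literature.Analysis.FluidPDE.HasRapidSpatialDecay (u 0) →
          ∀ l : ℝ, 0 < l → ∃ τ : ℝ, 0 < τ ∧ τ < T ∧ ∃ r : ℝ, 0 < r ∧ r ≤ ν / l ∧ r ^ 2 ≤ ν * τ ∧
            ∃ C : ℝ, ∀ t ∈ Set.Ico 0 T,
              MeasureTheory.IntegrableOn
                (fun z : ℝ × EuclideanSpace ℝ (Fin 3) =>
                  inner ℝ (Literature.Analysis.FluidPDE.curl (u z.1) z.2)
                    (fderiv ℝ (u z.1) z.2 (Literature.Analysis.FluidPDE.curl (u z.1) z.2)))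
                ({z : ℝ × EuclideanSpace ℝ (Fin 3) | z.1 ∈ Set.Ioo 0 t ∧ ‖u z.1 z.2‖ ≤ l} ∩
                  {z : ℝ × EuclideanSpace ℝ (Fin 3) | τ ≤ z.1 ∧
                    ∃ s ∈ Set.Icc (z.1 - r ^ 2 / ν) z.1, ∃ y ∈ Metric.closedBall z.2 r,
                      l < ‖u s y‖}) ∧
              ∫ z in ({z : ℝ × EuclideanSpace ℝ (Fin 3) | z.1 ∈ Set.Ioo 0 t ∧ ‖u z.1 z.2‖ ≤ l} ∩
                  {z : ℝ × EuclideanSpace ℝ (Fin 3) | τ ≤ z.1 ∧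
                    ∃ s ∈ Set.Icc (z.1 - r ^ 2 / ν) z.1, ∃ y ∈ Metric.closedBall z.2 r,
                      l < ‖u s y‖}),
                inner ℝ (Literature.Analysis.FluidPDE.curl (u z.1) z.2)
                  (fderiv ℝ (u z.1) z.2 (Literature.Analysis.FluidPDE.curl (u z.1) z.2)) ≤ C) →
    Summit.NavierStokesRegularity.NavierStokesRegularity.Theses.HodographBetchov.SlowClassProduction := by
  intro h₃ ν T hν hT u p hcl hLH hdec l hl
  obtain ⟨τ, hτ0, hτT, r, hr0, hrl, hrτ, C₂, hK⟩ := h₃ ν T hν hT u p hcl hLH hdec l hl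
  obtain ⟨C₁, hD⟩ := stub_deepSlowProduction ν T hν hT u p hcl hLH hdec l hl τ hτ0 hτT r hr0 hrl hrτ
  -- the production density
  set P : ℝ × EuclideanSpace ℝ (Fin 3) → ℝ := fun z =>
    inner ℝ (Literature.Analysis.FluidPDE.curl (u z.1) z.2)
      (fderiv ℝ (u z.1) z.2 (Literature.Analysis.FluidPDE.curl (u z.1) z.2)) with hP_def
  have hI : IntegrableOn P (Set.Ioo 0 τ ×ˢ (Set.univ : Set (EuclideanSpace ℝ (Fin 3)))) :=
    stub_slabProduction ν T hν hT u p hcl hLH hdec τ hτ0 hτT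
  refine ⟨(∫ z in Set.Ioo 0 τ ×ˢ (Set.univ : Set (EuclideanSpace ℝ (Fin 3))), |P z|) + C₁ + C₂, ?_⟩
  intro t ht
  -- the pieces of the slow class up to time `t`
  set S : Set (ℝ × EuclideanSpace ℝ (Fin 3)) :=
    {z : ℝ × EuclideanSpace ℝ (Fin 3) | z.1 ∈ Set.Ioo 0 t ∧ ‖u z.1 z.2‖ ≤ l} with hS_def
  set Dp : Set (ℝ × EuclideanSpace ℝ (Fin 3)) :=
    {z : ℝ × EuclideanSpace ℝ (Fin 3) | τ ≤ z.1 ∧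
      ∀ s ∈ Set.Icc (z.1 - r ^ 2 / ν) z.1, ∀ y ∈ Metric.closedBall z.2 r, ‖u s y‖ ≤ l} with hDp_def
  set Kc : Set (ℝ × EuclideanSpace ℝ (Fin 3)) :=
    {z : ℝ × EuclideanSpace ℝ (Fin 3) | τ ≤ z.1 ∧
      ∃ s ∈ Set.Icc (z.1 - r ^ 2 / ν) z.1, ∃ y ∈ Metric.closedBall z.2 r, l < ‖u s y‖} with hKc_def
  set Px : Set (ℝ × EuclideanSpace ℝ (Fin 3)) :=
    ⋂ σ ∈ Set.Icc (0 : ℝ) (r ^ 2 / ν), ⋂ η ∈ Metric.closedBall (0 : EuclideanSpace ℝ (Fin 3)) r,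
      ({z : ℝ × EuclideanSpace ℝ (Fin 3) | z.1 ∈ Set.Icc τ t} ∩
        (fun z : ℝ × EuclideanSpace ℝ (Fin 3) => u (z.1 - σ) (z.2 + η)) ⁻¹'
          Metric.closedBall (0 : EuclideanSpace ℝ (Fin 3)) l) with hPx_def
  change IntegrableOn P S ∧ ∫ z in S, P z ≤ _
  have hDt : IntegrableOn P (S ∩ Dp) ∧ ∫ z in S ∩ Dp, |P z| ≤ C₁ := hD t ht
  have hKt : IntegrableOn P (S ∩ Kc) ∧ ∫ z in S ∩ Kc, P z ≤ C₂ := hK t ht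
  -- continuity of the velocity on `[0,T) × ℝ³`
  have hsm : ContDiffOn ℝ ∞ (Function.uncurry u)
      (Set.Ico 0 T ×ˢ (Set.univ : Set (EuclideanSpace ℝ (Fin 3)))) := hcl.smooth_velocity
  have hU : ContinuousOn (Function.uncurry u)
      (Set.Ico 0 T ×ˢ (Set.univ : Set (EuclideanSpace ℝ (Fin 3)))) := hsm.continuousOn
  -- the two measurable cuts
  have hA : MeasurableSet {z : ℝ × EuclideanSpace ℝ (Fin 3) | z.1 < τ} :=
    measurableSet_lt measurable_fst measurable_const
  have hM : MeasurableSet Px := measurableSet_deepProxy hν hrτ ht.2 hU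
  have hDM : (S \ {z : ℝ × EuclideanSpace ℝ (Fin 3) | z.1 < τ}) ∩ Px = S ∩ Dp := slow_sdiff_inter_deepProxy
  have hKM : (S \ {z : ℝ × EuclideanSpace ℝ (Fin 3) | z.1 < τ}) \ Px = S ∩ Kc := slow_sdiff_sdiff_deepProxy
  -- the initial piece sits in the slab `(0,τ) × ℝ³`
  have hsub : S ∩ {z : ℝ × EuclideanSpace ℝ (Fin 3) | z.1 < τ} ⊆
      Set.Ioo 0 τ ×ˢ (Set.univ : Set (EuclideanSpace ℝ (Fin 3))) := by
    rintro z ⟨⟨hzt, _⟩, hzτ⟩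
    exact Set.mk_mem_prod ⟨hzt.1, hzτ⟩ (Set.mem_univ _)
  have hIA : IntegrableOn P (S ∩ {z : ℝ × EuclideanSpace ℝ (Fin 3) | z.1 < τ}) := hI.mono_set hsub
  -- integrability beyond the delay and on the whole slow class
  have hfar : S \ {z : ℝ × EuclideanSpace ℝ (Fin 3) | z.1 < τ} = (S ∩ Dp) ∪ (S ∩ Kc) := by
    rw [← hDM, ← hKM, Set.inter_union_sdiff]
  have hSA : IntegrableOn P (S \ {z : ℝ × EuclideanSpace ℝ (Fin 3) | z.1 < τ}) := by
    rw [hfar]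
    exact hDt.1.union hKt.1
  have hS : IntegrableOn P S := by
    rw [← Set.inter_union_sdiff S {z : ℝ × EuclideanSpace ℝ (Fin 3) | z.1 < τ}]
    exact hIA.union hSA
  refine ⟨hS, ?_⟩
  -- split the integral twice
  have e1 := integral_inter_add_sdiff hA hS
  have e2 := integral_inter_add_sdiff hM hSA
  rw [hDM, hKM] at e2
  -- bound the three pieces
  have b0 : ∫ z in S ∩ {z : ℝ × EuclideanSpace ℝ (Fin 3) | z.1 < τ}, P z ≤
      ∫ z in Set.Ioo 0 τ ×ˢ (Set.univ : Set (EuclideanSpace ℝ (Fin 3))), |P z| :=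
    calc ∫ z in S ∩ {z : ℝ × EuclideanSpace ℝ (Fin 3) | z.1 < τ}, P z
        ≤ ∫ z in S ∩ {z : ℝ × EuclideanSpace ℝ (Fin 3) | z.1 < τ}, |P z| :=
          integral_mono hIA hIA.abs fun z => le_abs_self _
      _ ≤ ∫ z in Set.Ioo 0 τ ×ˢ (Set.univ : Set (EuclideanSpace ℝ (Fin 3))), |P z| :=
          setIntegral_mono_set hI.abs (ae_of_all _ fun z => abs_nonneg _) hsub.eventuallyLE
  have b1 : ∫ z in S ∩ Dp, P z ≤ C₁ :=
    le_trans (integral_mono hDt.1 hDt.1.abs fun z => le_abs_self _) hDt.2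
  have b2 : ∫ z in S ∩ Kc, P z ≤ C₂ := hKt.2
  rw [← e1, ← e2]
  linarith

end Summit.NavierStokesRegularity.NavierStokesRegularity.Theorems.SlowClassProduction.Birth

end
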